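import Summits.Ventures.GridStability.Models.InverterDroopFirstOrderVICCT

/-!
# GridStability/Models/InverterDroopGainSchedule — the post-fault return / pole slip of the first-order droop GFM holds for EVERY positive gain schedule `k_i(t) = κ(t)·k_i` (non-autonomous phase line), 0 kit

Cell `gridfusion` (LADDER-GRIDFUSION rung G3.a; seat gridfusion-model-3 (g10)); companion of
`InverterDroopVariableDroopCCT` (Qoria §V.5 «variable droop gain»: (V-30)/(V-31) `k_i = α k_i0` switched on
the current, (V-33) `k_i` scheduled on the voltage reference) whose instance theorems keep the gain FROZEN at
`α k_i0` through the return.  THIS FILE removes that restriction for the qualitative statements: §1 the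
NON-AUTONOMOUS phase line — for `x' = κ(t) f(x)` with a gain multiplier `κ(t) ∈ [κ₁, κ₂] ⊂ (0, ∞)` the barriers
(`le_init_of_neg_sched`, `expLower_le_of_neg_sched`) and the monotone convergence to the adjacent zero
(`tendsto_of_neg_sched` / `tendsto_of_pos_sched`) of `ScalarPhaseLine` hold verbatim (the tree's first-exit
barrier lemma already takes a time-dependent derivative; compactness step with `κ ≥ κ₁`); §2 the droop layer
— `firstOrder_return_sched` (cleared at `δ(0) ∈ (δ₀, π − δ₀)`: monotone return to `δ₀` under ANY such schedule),
`firstOrder_poleSlip_sched` (cleared beyond `π − δ₀`: monotone drift to `2π + δ₀` under ANY such schedule — no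
post-fault gain scheduling rescues a fault cleared past `δ_max`).  Consequence for §V.5: on MODEL M_droop1 the
critical clearing ANGLE `δ_max = π − δ₀` (V-16) does not depend on the post-fault gain schedule at all; the gain
acts only through the fault-on excursion ((V-26) with a schedule: `δ₀ + p*·∫k_i`).  (The VI-curve / finite-phase
versions follow the same way from `le_init_of_neg_sched` through `lossyShift`; successor item.)
THREE COLUMNS.  CERTIFIED: theorems of MODEL M_droop1 with a time-varying gain multiplier
`κ : ℝ → ℝ`, `κ₁ ≤ κ(t) ≤ κ₂`, `κ₁ > 0` (tree convention: the solution has the derivative `κ(t)·field` at every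
`t`; no existence claim).  VALIDATED: nothing numerical.  MODELLED: (V-31)/(V-33) produce such a multiplier
(`α ∈ {0.1, 1}` resp. `(‖e_g*‖)^n ∈ (0, 1]`); a schedule with jumps is covered phase by phase (derivative within
each phase); nothing about a device. [cite: Qoria2020, §V.5 (V-30)–(V-33); §V.3.1–§V.3.2]
-/

noncomputable section

open Real Set Filter Topology

namespace Summit.Ventures.GridStability.Models

namespace ScalarFlow

/-! ## §1 Non-autonomous phase line: `x' = κ(t) f(x)`, `0 < κ₁ ≤ κ ≤ κ₂` -/

/-- Upper barrier with a positive gain multiplier: `x' = κ(t) f(x)` within `[0, T]`, `κ > 0` on `[0, T]`,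
`f(x 0) < 0` ⇒ `x t ≤ x 0` on `[0, T]`. [folklore] -/
theorem le_init_of_neg_sched {x f κ : ℝ → ℝ} {T : ℝ}
    (hx : ∀ t ∈ Icc 0 T, HasDerivWithinAt x (κ t * f (x t)) (Icc 0 T) t)
    (hκ : ∀ t ∈ Icc 0 T, 0 < κ t) (h0 : f (x 0) < 0) :
    ∀ t ∈ Icc 0 T, x t ≤ x 0 := by
  have h := Literature.Analysis.ODE.forall_le_of_hasDerivWithinAt_of_eq_imp_deriv_neg
    (ι := Unit) (h := fun _ => x) (h' := fun _ t => κ t * f (x t)) (c := fun _ => x 0) (T := T)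
    (fun _ => hx) (fun t ht _ _ hk => by
      show κ t * f (x t) < 0; rw [hk]; exact mul_neg_of_pos_of_neg (hκ t ht) h0) (fun _ => le_rfl)
  exact fun t ht => h t ht ()

/-- Lower exponential barrier with a bounded positive gain multiplier: moreover `a < x 0 ≤ b`, `f < 0` on
`(a, b]`, `f y ≥ −L (y − a)` there with `L ≥ 0`, `0 < κ ≤ κ₂` on `[0, T]` ⇒
`a + (x 0 − a) e^{−(κ₂ L + 1)t} ≤ x t` on `[0, T]` (the zero `a` is never reached). [folklore] -/
theorem expLower_le_of_neg_sched {x f κ : ℝ → ℝ} {a b L κ₂ T : ℝ}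
    (hx : ∀ t ∈ Icc 0 T, HasDerivWithinAt x (κ t * f (x t)) (Icc 0 T) t)
    (hκ : ∀ t ∈ Icc 0 T, 0 < κ t ∧ κ t ≤ κ₂)
    (h0 : x 0 ∈ Ioc a b) (hneg : ∀ y ∈ Ioc a b, f y < 0) (hL : 0 ≤ L)
    (hlip : ∀ y ∈ Ioc a b, -(L * (y - a)) ≤ f y) :
    ∀ t ∈ Icc 0 T, a + (x 0 - a) * exp (-(κ₂ * L + 1) * t) ≤ x t := by
  have hup := le_init_of_neg_sched hx (fun t ht => (hκ t ht).1) (hneg _ h0)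
  have hyd : ∀ t, HasDerivWithinAt (fun s => a + (x 0 - a) * exp (-(κ₂ * L + 1) * s))
      ((x 0 - a) * (exp (-(κ₂ * L + 1) * t) * (-(κ₂ * L + 1)))) (Icc 0 T) t := by
    intro t
    exact ((((hasDerivWithinAt_id t (Icc 0 T)).const_mul (-(κ₂ * L + 1))).exp.const_mul
      (x 0 - a)).const_add a).congr_deriv (by simp)
  have h := Literature.Analysis.ODE.forall_le_of_hasDerivWithinAt_of_eq_imp_deriv_neg
    (ι := Unit) (h := fun _ t => a + (x 0 - a) * exp (-(κ₂ * L + 1) * t) - x t)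
    (h' := fun _ t => (x 0 - a) * (exp (-(κ₂ * L + 1) * t) * (-(κ₂ * L + 1))) - κ t * f (x t))
    (c := fun _ => 0) (T := T) (fun _ t ht => (hyd t).sub (hx t ht)) ?_ ?_
  · intro t ht
    have := h t ht ()
    linarith
  · intro t ht _ _ hk
    set E := (x 0 - a) * exp (-(κ₂ * L + 1) * t) with hE_def
    have hE : 0 < E := mul_pos (by linarith [h0.1]) (exp_pos _)
    have hxt : x t - a = E := by change a + E - x t = 0 at hk; linarith
    have hmem : x t ∈ Ioc a b := ⟨by linarith, (hup t ht).trans h0.2⟩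
    have hl := hlip _ hmem
    rw [hxt] at hl
    obtain ⟨hκ0, hκ2⟩ := hκ t ht
    -- κ t * f (x t) ≥ -κ₂ L E
    have hLE : 0 ≤ L * E := mul_nonneg hL hE.le
    have hkf : -(κ₂ * (L * E)) ≤ κ t * f (x t) := by nlinarith
    have h3 : (x 0 - a) * (exp (-(κ₂ * L + 1) * t) * (-(κ₂ * L + 1))) = -(κ₂ * L + 1) * E := by
      rw [hE_def]; ring
    show (x 0 - a) * (exp (-(κ₂ * L + 1) * t) * (-(κ₂ * L + 1))) - κ t * f (x t) < 0
    rw [h3]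
    nlinarith
  · intro _
    simp

/-- **Non-autonomous sign lemma (decreasing side).** `x' = κ(t) f(x)` within `[0, ∞)` with
`κ₁ ≤ κ(t) ≤ κ₂`, `κ₁ > 0`; `a < x 0 ≤ b`, `f` continuous on `[a, b]`, negative on `(a, b]`, `f y ≥ −L(y − a)`
there (`L ≥ 0`).  Then `a < x t ≤ x 0` for `t ≥ 0`, `x` is non-increasing on `[0, ∞)` and `x t → a`. [folklore] -/
theorem tendsto_of_neg_sched {x f κ : ℝ → ℝ} {a b L κ₁ κ₂ : ℝ}
    (hx : ∀ t ∈ Ici (0:ℝ), HasDerivWithinAt x (κ t * f (x t)) (Ici 0) t)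
    (hκ : ∀ t, 0 ≤ t → κ₁ ≤ κ t ∧ κ t ≤ κ₂) (hκ₁ : 0 < κ₁)
    (h0 : x 0 ∈ Ioc a b) (hneg : ∀ y ∈ Ioc a b, f y < 0) (hL : 0 ≤ L)
    (hlip : ∀ y ∈ Ioc a b, -(L * (y - a)) ≤ f y) (hf : ContinuousOn f (Icc a b)) :
    (∀ t, 0 ≤ t → a < x t ∧ x t ≤ x 0) ∧ AntitoneOn x (Ici 0) ∧ Tendsto x atTop (𝓝 a) := by
  have hκpos : ∀ t, 0 ≤ t → 0 < κ t := fun t ht => hκ₁.trans_le (hκ t ht).1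
  have hxT : ∀ T, ∀ t ∈ Icc 0 T, HasDerivWithinAt x (κ t * f (x t)) (Icc 0 T) t :=
    fun T t ht => (hx t ht.1).mono Icc_subset_Ici_self
  have hbd : ∀ t, 0 ≤ t → a < x t ∧ x t ≤ x 0 := by
    intro t ht
    refine ⟨?_, le_init_of_neg_sched (hxT t) (fun s hs => hκpos s hs.1) (hneg _ h0) t ⟨ht, le_rfl⟩⟩
    have h1 := expLower_le_of_neg_sched (hxT t) (fun s hs => ⟨hκpos s hs.1, (hκ s hs.1).2⟩) h0 hneg hL
      hlip t ⟨ht, le_rfl⟩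
    have : 0 < (x 0 - a) * exp (-(κ₂ * L + 1) * t) := mul_pos (by linarith [h0.1]) (exp_pos _)
    linarith
  have hcont : ContinuousOn x (Ici 0) := fun t ht => (hx t ht).continuousWithinAt
  have hint : interior (Ici (0:ℝ)) = Ioi 0 := interior_Ici
  have hanti : AntitoneOn x (Ici 0) := by
    refine antitoneOn_of_hasDerivWithinAt_nonpos (convex_Ici 0) hcont (f' := fun t => κ t * f (x t)) ?_ ?_
    · intro t ht
      rw [hint] at ht ⊢
      exact (hx t (mem_Ici.2 ht.le)).mono Ioi_subset_Ici_self
    · intro t ht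
      rw [hint] at ht
      have := hbd t ht.le
      exact (mul_neg_of_pos_of_neg (hκpos t ht.le) (hneg _ ⟨this.1, this.2.trans h0.2⟩)).le
  refine ⟨hbd, hanti, ?_⟩
  set xt : ℝ → ℝ := fun t => x (max t 0) with hxt
  have hxt_anti : Antitone xt := by
    intro s t hst
    exact hanti (le_max_right s 0) (le_max_right t 0) (max_le_max hst le_rfl)
  have hxt_bdd : BddBelow (range xt) := by
    refine ⟨a, ?_⟩
    rintro _ ⟨t, rfl⟩
    exact (hbd _ (le_max_right t 0)).1.le
  have hlim0 : Tendsto xt atTop (𝓝 (⨅ t, xt t)) := tendsto_atTop_ciInf hxt_anti hxt_bdd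
  obtain ⟨ℓ, hℓ⟩ : ∃ ℓ, ℓ = ⨅ t, xt t := ⟨_, rfl⟩
  have hlim : Tendsto xt atTop (𝓝 ℓ) := by rw [hℓ]; exact hlim0
  have heq : xt =ᶠ[atTop] x := by
    filter_upwards [eventually_ge_atTop (0:ℝ)] with t ht
    simp only [hxt, max_eq_left ht]
  have hlimx : Tendsto x atTop (𝓝 ℓ) := hlim.congr' heq
  have hℓa : a ≤ ℓ := by rw [hℓ]; exact le_ciInf fun t => (hbd _ (le_max_right t 0)).1.le
  have hxℓ : ∀ t, 0 ≤ t → ℓ ≤ x t := by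
    intro t ht
    have := ciInf_le hxt_bdd t
    simp only [hxt, max_eq_left ht] at this
    rw [hℓ]; exact this
  rcases eq_or_ne ℓ a with hℓ_eq | hne
  · rw [hℓ_eq] at hlimx; exact hlimx
  exfalso
  have hℓa' : a < ℓ := lt_of_le_of_ne hℓa (Ne.symm hne)
  have hsub : Icc ℓ (x 0) ⊆ Icc a b := Icc_subset_Icc hℓa h0.2
  have hne' : (Icc ℓ (x 0)).Nonempty := ⟨x 0, hxℓ 0 le_rfl, le_rfl⟩
  obtain ⟨y₀, hy₀, hmax⟩ := isCompact_Icc.exists_isMaxOn hne' (hf.mono hsub)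
  have hm : f y₀ < 0 := hneg _ ⟨hℓa'.trans_le hy₀.1, hy₀.2.trans h0.2⟩
  have hg : AntitoneOn (fun t => x t - κ₁ * f y₀ * t) (Ici 0) := by
    refine antitoneOn_of_hasDerivWithinAt_nonpos (convex_Ici 0)
      (hcont.sub (continuousOn_const.mul continuousOn_id))
      (f' := fun t => κ t * f (x t) - κ₁ * f y₀ * 1) ?_ ?_
    · intro t ht
      rw [hint] at ht ⊢
      exact ((hx t (mem_Ici.2 ht.le)).mono Ioi_subset_Ici_self).sub
        ((hasDerivWithinAt_id t (Ioi 0)).const_mul (κ₁ * f y₀))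
    · intro t ht
      rw [hint] at ht
      have hxmem : x t ∈ Icc ℓ (x 0) := ⟨hxℓ t ht.le, (hbd t ht.le).2⟩
      have hfx : f (x t) ≤ f y₀ := isMaxOn_iff.1 hmax (x t) hxmem
      have hκt := (hκ t ht.le).1
      nlinarith
  set t₁ : ℝ := (x 0 - ℓ + 1) / (-(κ₁ * f y₀)) with ht₁
  have hden : 0 < -(κ₁ * f y₀) := by nlinarith
  have ht₁pos : 0 < t₁ := div_pos (by linarith [hxℓ 0 le_rfl]) hden
  have h1 := hg (self_mem_Ici : (0:ℝ) ∈ Ici 0) ht₁pos.le ht₁pos.le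
  simp only [mul_zero, sub_zero] at h1
  have h2 : κ₁ * f y₀ * t₁ = -(x 0 - ℓ + 1) := by
    rw [ht₁, mul_div_assoc', div_eq_iff hden.ne']
    ring
  have h3 := hxℓ t₁ ht₁pos.le
  linarith

/-- **Non-autonomous sign lemma (increasing side)**, mirror image: `b ≤ x 0 < a`, `f` continuous on `[b, a]`,
positive on `[b, a)`, `f y ≤ L(a − y)` there (`L ≥ 0`), gain multiplier as above ⇒ `x 0 ≤ x t < a`, `x`
non-decreasing, `x t → a`. [folklore] -/
theorem tendsto_of_pos_sched {x f κ : ℝ → ℝ} {a b L κ₁ κ₂ : ℝ}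
    (hx : ∀ t ∈ Ici (0:ℝ), HasDerivWithinAt x (κ t * f (x t)) (Ici 0) t)
    (hκ : ∀ t, 0 ≤ t → κ₁ ≤ κ t ∧ κ t ≤ κ₂) (hκ₁ : 0 < κ₁)
    (h0 : x 0 ∈ Ico b a) (hpos : ∀ y ∈ Ico b a, 0 < f y) (hL : 0 ≤ L)
    (hlip : ∀ y ∈ Ico b a, f y ≤ L * (a - y)) (hf : ContinuousOn f (Icc b a)) :
    (∀ t, 0 ≤ t → x 0 ≤ x t ∧ x t < a) ∧ MonotoneOn x (Ici 0) ∧ Tendsto x atTop (𝓝 a) := by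
  have h := tendsto_of_neg_sched (x := fun t => -x t) (f := fun y => -f (-y)) (κ := κ) (a := -a) (b := -b)
    (L := L) (fun t ht => by
      have h := (hx t ht).neg
      simp only [neg_neg]
      exact h.congr_deriv (by ring)) hκ hκ₁
    ⟨by simp only [neg_lt_neg_iff]; exact h0.2, by simp only [neg_le_neg_iff]; exact h0.1⟩
    (fun y hy => by
      have : -y ∈ Ico b a := ⟨by linarith [hy.2], by linarith [hy.1]⟩
      linarith [hpos _ this]) hL
    (fun y hy => by
      have : -y ∈ Ico b a := ⟨by linarith [hy.2], by linarith [hy.1]⟩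
      have := hlip _ this
      linarith)
    (by
      have hmaps : MapsTo (fun y : ℝ => -y) (Icc (-a) (-b)) (Icc b a) := fun y hy =>
        ⟨by linarith [hy.2], by linarith [hy.1]⟩
      exact (hf.comp continuousOn_neg hmaps).neg)
  obtain ⟨hbd, hanti, hlim⟩ := h
  refine ⟨fun t ht => ?_, fun s hs t ht hst => ?_, ?_⟩
  · have := hbd t ht; constructor <;> linarith [this.1, this.2]
  · have := hanti hs ht hst; simp only [neg_le_neg_iff] at this; exact this
  · simpa using hlim.neg

end ScalarFlow

namespace InverterDroop.ReducedParams

open ScalarFlow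

variable {P : ReducedParams}

/-! ## §2 The first-order droop GFM with a scheduled gain `k_i(t) = κ(t) k_i` -/

/-- **Return under ANY positive gain schedule.**  `ω_set = ω_e`, `k_i, P_max > 0`, `δ₀ ∈ [−π/2, π/2]` with
`P_max sin δ₀ = p*`; gain multiplier `κ₁ ≤ κ(t) ≤ κ₂`, `κ₁ > 0`.  Every motion of `δ̇ = κ(t)·k_i(p* − P_max sin δ)`
on `[0, ∞)` cleared at `δ(0) ∈ (δ₀, π − δ₀)` decreases monotonically and tends to `δ₀`.
[cite: Qoria2020, §V.3.1 (V-15)–(V-16); §V.5 (V-30)–(V-33)] -/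
theorem firstOrder_return_sched (hω : P.ωset = P.ωe) (hk : 0 < P.ki) (hPm : 0 < P.Pmax)
    {δ₀ : ℝ} (hδ₀ : δ₀ ∈ Icc (-(π / 2)) (π / 2)) (heq : P.Pmax * sin δ₀ = P.pref)
    {κ : ℝ → ℝ} {κ₁ κ₂ : ℝ} (hκ : ∀ t, 0 ≤ t → κ₁ ≤ κ t ∧ κ t ≤ κ₂) (hκ₁ : 0 < κ₁)
    {δ : ℝ → ℝ} (hδ : ∀ t ∈ Ici (0:ℝ), HasDerivWithinAt δ (κ t * P.dδFirstOrder (δ t)) (Ici 0) t)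
    (hc : δ 0 ∈ Ioo δ₀ (π - δ₀)) :
    (∀ t, 0 ≤ t → δ₀ < δ t ∧ δ t ≤ δ 0) ∧ AntitoneOn δ (Ici 0) ∧ Tendsto δ atTop (𝓝 δ₀) := by
  refine tendsto_of_neg_sched (f := P.dδFirstOrder) (b := δ 0) (L := P.ki * P.Pmax) hδ hκ hκ₁
    ⟨hc.1, le_rfl⟩ ?_ (mul_pos hk hPm).le ?_ P.continuous_dδFirstOrder.continuousOn
  · intro y hy
    rw [P.dδFirstOrder_eq hω, ← heq]
    have := sin_lt_sin_of_mem_window hδ₀ ⟨hy.1, lt_of_le_of_lt hy.2 hc.2⟩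
    rw [show P.ki * (P.Pmax * sin δ₀ - P.Pmax * sin y) = P.ki * P.Pmax * (sin δ₀ - sin y) by ring]
    exact mul_neg_of_pos_of_neg (mul_pos hk hPm) (by linarith)
  · intro y hy
    rw [P.dδFirstOrder_eq hω, ← heq]
    have := sin_sub_sin_le_sub hy.1
    rw [show P.ki * (P.Pmax * sin δ₀ - P.Pmax * sin y) = -(P.ki * P.Pmax * (sin y - sin δ₀)) by ring]
    exact neg_le_neg (mul_le_mul_of_nonneg_left this (mul_pos hk hPm).le)

/-- **Pole slip under ANY positive gain schedule.**  Same record and multiplier; cleared at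
`δ(0) ∈ (π − δ₀, 2π + δ₀)` the motion increases monotonically to the next equilibrium `2π + δ₀` — no post-fault
gain scheduling rescues a fault cleared beyond `δ_max = π − δ₀`. [cite: Qoria2020, §V.3.1; §V.5] -/
theorem firstOrder_poleSlip_sched (hω : P.ωset = P.ωe) (hk : 0 < P.ki) (hPm : 0 < P.Pmax)
    {δ₀ : ℝ} (hδ₀ : δ₀ ∈ Icc (-(π / 2)) (π / 2)) (heq : P.Pmax * sin δ₀ = P.pref)
    {κ : ℝ → ℝ} {κ₁ κ₂ : ℝ} (hκ : ∀ t, 0 ≤ t → κ₁ ≤ κ t ∧ κ t ≤ κ₂) (hκ₁ : 0 < κ₁)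
    {δ : ℝ → ℝ} (hδ : ∀ t ∈ Ici (0:ℝ), HasDerivWithinAt δ (κ t * P.dδFirstOrder (δ t)) (Ici 0) t)
    (hc : δ 0 ∈ Ioo (π - δ₀) (2 * π + δ₀)) :
    (∀ t, 0 ≤ t → δ 0 ≤ δ t ∧ δ t < 2 * π + δ₀) ∧ MonotoneOn δ (Ici 0) ∧
      Tendsto δ atTop (𝓝 (2 * π + δ₀)) := by
  have hsin2 : sin (2 * π + δ₀) = sin δ₀ := by rw [sin_add]; simp
  refine tendsto_of_pos_sched (f := P.dδFirstOrder) (b := δ 0) (L := P.ki * P.Pmax) hδ hκ hκ₁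
    ⟨le_rfl, hc.2⟩ ?_ (mul_pos hk hPm).le ?_ P.continuous_dδFirstOrder.continuousOn
  · intro y hy
    rw [P.dδFirstOrder_eq hω, ← heq]
    have h1 := sin_lt_sin_of_mem_upper hδ₀ ⟨hc.1.trans_le hy.1, hy.2⟩
    rw [show P.ki * (P.Pmax * sin δ₀ - P.Pmax * sin y) = P.ki * P.Pmax * (sin δ₀ - sin y) by ring]
    exact mul_pos (mul_pos hk hPm) (by linarith)
  · intro y hy
    rw [P.dδFirstOrder_eq hω, ← heq, ← hsin2]
    have := sin_sub_sin_le_sub hy.2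
    rw [show P.ki * (P.Pmax * sin (2 * π + δ₀) - P.Pmax * sin y)
      = P.ki * P.Pmax * (sin (2 * π + δ₀) - sin y) by ring]
    exact mul_le_mul_of_nonneg_left this (mul_pos hk hPm).le

end InverterDroop.ReducedParams

end Summit.Ventures.GridStability.Models

end
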